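import Literature.Geometry.Lorentzian.RadialLengthBound
import Literature.Geometry.Riemannian.MaximalGeodesicRescaling
import Mathlib.Analysis.Calculus.LocalExtr.Basic
import Mathlib.Analysis.SpecialFunctions.Sqrt
import HarnessLib

/-!
# First variation of the radial distance, and elementary growth lemmas
(towards the corner-cutting step of O'Neill 1983, Ch. 10, Prop. 10.46 / Ch. 14, Prop. 14.19)

Tools for the analysis of a vertex of a maximal broken causal geodesic:

* `LorentzianMetric.hasDerivAt_val_self_radial` — **first variation of the squared radial
  distance**: for a curve `β` in `T_oM` inside the domain of `exp_o`, the function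
  `s ↦ g_o(β s, β s)` has derivative `2 g(α' s, P)` where `α = exp_o ∘ β` and `P` is the velocity
  at `r = 1` of the radial geodesic `r ↦ exp_o(r β s)` (the Gauss lemma along a curve,
  `val_deriv_self_eq_val_velocity_radial`, O'Neill 1983, Ch. 5, Lemma 5.33 / Cor. 5.2);
* `maximalGeodesic_translate_apply`, `velocity_maximalGeodesic_translate` — the flow property of
  maximal geodesics at the level of points and velocities; `velocity_expMap_smul_smul_one` — the
  velocity at `r = 1` of `r ↦ exp_x(r (c v))` is `c γ_v'(c)`;
* three lemmas of real analysis used to exclude a null–timelike vertex: a function vanishing at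
  `0` with negative derivative there has `√(-Q s) ≥ c √s` for small `s > 0`
  (`sqrt_mul_sqrt_le_of_hasDerivAt_neg`), a function differentiable at `0` is bounded below by
  `D 0 - C |s|` near `0` (`sub_mul_abs_le_of_hasDerivAt`), and the two bounds are incompatible
  with a one-sided local maximum at `0` of `D₁ + D₂` (`not_sqrt_growth_of_le`).

Everything is proved; no definitions and no named facts are introduced (D-0026).

## References

* B. O'Neill, *Semi-Riemannian geometry with applications to relativity*, Academic Press 1983,
  Ch. 5, Cor. 5.2, Lemma 5.33 (p. 147); Ch. 10, Prop. 10.46; Ch. 14, Prop. 14.19.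
  [ONeillSemiRiemannian1983]
-/

noncomputable section

open Bundle Set Filter Function Topology
open scoped Manifold ContDiff

namespace Literature.Geometry.Lorentzian

open Literature.Geometry.Riemannian

/-! ### Real analysis -/

/-- If `Q 0 = 0` and `Q' < 0` at `0`, then `√(-Q'/2) √s ≤ √(-Q s)` for small `s > 0`.
[folklore] -/
lemma sqrt_mul_sqrt_le_of_hasDerivAt_neg {Q : ℝ → ℝ} {Q' : ℝ} (hQ : HasDerivAt Q Q' 0)
    (hQ0 : Q 0 = 0) (hQ' : Q' < 0) :
    ∀ᶠ s in 𝓝[>] (0 : ℝ), Real.sqrt (-Q' / 2) * Real.sqrt s ≤ Real.sqrt (-Q s) := by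
  have hslope : Tendsto (slope Q 0) (𝓝[≠] 0) (𝓝 Q') := hasDerivAt_iff_tendsto_slope.1 hQ
  have hslope' : Tendsto (slope Q 0) (𝓝[>] 0) (𝓝 Q') :=
    hslope.mono_left (nhdsWithin_mono _ fun s hs ↦ ne_of_gt hs)
  have hev : ∀ᶠ s in 𝓝[>] (0 : ℝ), slope Q 0 s < Q' / 2 :=
    hslope'.eventually (Iio_mem_nhds (by linarith))
  filter_upwards [hev, self_mem_nhdsWithin] with s hs hs0
  have hs0' : (0 : ℝ) < s := hs0
  rw [slope_def_field, hQ0, sub_zero, sub_zero, div_lt_iff₀ hs0'] at hs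
  have h1 : -Q' / 2 * s ≤ -Q s := by linarith
  calc Real.sqrt (-Q' / 2) * Real.sqrt s = Real.sqrt (-Q' / 2 * s) :=
        (Real.sqrt_mul (by linarith) s).symm
    _ ≤ Real.sqrt (-Q s) := Real.sqrt_le_sqrt h1

/-- A function differentiable at `0` is bounded below by `D 0 - C |s|` near `0`, for some `C > 0`.
[folklore] -/
lemma sub_mul_abs_le_of_hasDerivAt {D : ℝ → ℝ} {D' : ℝ} (hD : HasDerivAt D D' 0) :
    ∃ C : ℝ, 0 < C ∧ ∀ᶠ s in 𝓝 (0 : ℝ), D 0 - C * |s| ≤ D s := by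
  obtain ⟨C, hC, h⟩ := (hD.isBigO_sub).exists_pos
  rw [Asymptotics.IsBigOWith] at h
  refine ⟨C, hC, ?_⟩
  filter_upwards [h] with s hs
  rw [Real.norm_eq_abs, Real.norm_eq_abs, sub_zero] at hs
  have := (abs_le.1 hs).1
  linarith

/-- A `√s` gain cannot be compensated by a linear loss: if `D₁ 0 = 0`, `D₁ s ≥ c √s` (`c > 0`) and
`D₂ s ≥ D₂ 0 - C s` for small `s > 0`, then `D₁ s + D₂ s ≤ D₁ 0 + D₂ 0` fails for some small
`s > 0`. [folklore] -/
lemma not_sqrt_growth_of_le {D₁ D₂ : ℝ → ℝ} {c C : ℝ} (hc : 0 < c)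
    (hmax : ∀ᶠ s in 𝓝[>] (0 : ℝ), D₁ s + D₂ s ≤ D₁ 0 + D₂ 0) (h1 : D₁ 0 = 0)
    (hg : ∀ᶠ s in 𝓝[>] (0 : ℝ), c * Real.sqrt s ≤ D₁ s)
    (hl : ∀ᶠ s in 𝓝[>] (0 : ℝ), D₂ 0 - C * s ≤ D₂ s) : False := by
  -- `√s < c / (|C| + 1)` for small `s`
  have hsmall : ∀ᶠ s in 𝓝[>] (0 : ℝ), Real.sqrt s < c / (|C| + 1) := by
    have hcont : Tendsto Real.sqrt (𝓝[>] (0 : ℝ)) (𝓝 0) := by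
      have h := Real.continuous_sqrt.tendsto (0 : ℝ)
      rw [Real.sqrt_zero] at h
      exact h.mono_left nhdsWithin_le_nhds
    exact hcont.eventually (Iio_mem_nhds (by positivity))
  obtain ⟨s, ⟨hm, hg', hl', hsm⟩, hs0⟩ :=
    ((hmax.and (hg.and (hl.and hsmall))).and self_mem_nhdsWithin).exists
  have hs0' : (0 : ℝ) < s := hs0
  have hsq : 0 < Real.sqrt s := Real.sqrt_pos.2 hs0'
  have hss : s = Real.sqrt s * Real.sqrt s := (Real.mul_self_sqrt hs0'.le).symm
  -- `c √s ≤ C s ≤ |C| s`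
  have h2 : c * Real.sqrt s ≤ C * s := by linarith
  have h3 : C * s ≤ |C| * s := mul_le_mul_of_nonneg_right (le_abs_self C) hs0'.le
  have h4 : |C| * s = |C| * Real.sqrt s * Real.sqrt s := by rw [mul_assoc, ← hss]
  have h5 : c ≤ |C| * Real.sqrt s := by
    have : c * Real.sqrt s ≤ |C| * Real.sqrt s * Real.sqrt s := by linarith
    exact le_of_mul_le_mul_right this hsq
  have h6 : |C| * Real.sqrt s < |C| * (c / (|C| + 1)) + (c - |C| * (c / (|C| + 1))) := by
    have hA : 0 ≤ |C| := abs_nonneg C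
    have h7 : |C| * Real.sqrt s ≤ |C| * (c / (|C| + 1)) :=
      mul_le_mul_of_nonneg_left hsm.le hA
    have h8 : 0 < c - |C| * (c / (|C| + 1)) := by
      rw [mul_div_assoc', sub_pos, div_lt_iff₀ (by positivity)]
      nlinarith
    linarith
  linarith

variable {E : Type*} [NormedAddCommGroup E] [NormedSpace ℝ E] {H : Type*} [TopologicalSpace H]
  {I : ModelWithCorners ℝ E H} {M : Type*} [TopologicalSpace M] [ChartedSpace H M]
  [IsManifold I ∞ M] [FiniteDimensional ℝ E] [CompleteSpace E] [T2Space M]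
  [BoundarylessManifold I M]

/-! ### Flow property at the level of points and velocities -/

section Flow

variable {cov : CovariantDerivative I E (TangentSpace I : M → Type _)}
  [CovariantDerivative.ContMDiffCovariantDerivative cov 1]

/-- **Flow property, points**: `γ_q(s) = γ_p(s + t₀)` for `q = (γ_p(t₀), γ_p'(t₀))`
(`maximalGeodesic_translate`). [cite: LeeRiemannianManifolds2018, Thm. 4.27] -/
theorem maximalGeodesic_translate_apply (x : M) (v : TangentSpace I x) {t₀ : ℝ}
    (ht₀ : t₀ ∈ maximalGeodesicDomain cov x v) {s : ℝ}
    (hs : s + t₀ ∈ maximalGeodesicDomain cov x v) :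
    maximalGeodesic cov (maximalGeodesic cov x v t₀) (velocity I (maximalGeodesic cov x v) t₀) s =
      maximalGeodesic cov x v (s + t₀) := by
  have h := (maximalGeodesic_translate (cov := cov) x v ht₀ hs).2
  exact congrArg TotalSpace.proj h

/-- **Flow property, velocities**: `γ_q'(s) = γ_p'(s + t₀)` for `q = (γ_p(t₀), γ_p'(t₀))`
(`maximalGeodesic_translate`; the fibres of `TM` are all the model space, so the heterogeneous
equality of velocities is an equality). [cite: LeeRiemannianManifolds2018, Thm. 4.27] -/
theorem velocity_maximalGeodesic_translate (x : M) (v : TangentSpace I x) {t₀ : ℝ}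
    (ht₀ : t₀ ∈ maximalGeodesicDomain cov x v) {s : ℝ}
    (hs : s + t₀ ∈ maximalGeodesicDomain cov x v) :
    (velocity I (maximalGeodesic cov (maximalGeodesic cov x v t₀)
        (velocity I (maximalGeodesic cov x v) t₀)) s : E) =
      velocity I (maximalGeodesic cov x v) (s + t₀) := by
  have h := (maximalGeodesic_translate (cov := cov) x v ht₀ hs).2
  have h2 : HEq (tangentLift I (maximalGeodesic cov (maximalGeodesic cov x v t₀)
      (velocity I (maximalGeodesic cov x v) t₀)) s).2
      (tangentLift I (maximalGeodesic cov x v) (s + t₀)).2 := by rw [h]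
  exact eq_of_heq h2

/-- Near `r = r₀` with `c r₀ ∈ dom γ_v`, `exp_x(r (c v)) = γ_v(c r)`. [folklore] -/
theorem expMap_smul_smul_eventuallyEq (x : M) (v : TangentSpace I x) {c r₀ : ℝ}
    (hc : c * r₀ ∈ maximalGeodesicDomain cov x v) :
    (fun r : ℝ ↦ expMap cov x (r • (c • v))) =ᶠ[𝓝 r₀]
      fun r ↦ maximalGeodesic cov x v (c * r + 0) := by
  obtain ⟨hmax, -, -, -⟩ := maximalGeodesic_spec' (cov := cov) x v
  have hev : ∀ᶠ r in 𝓝 r₀, c * r ∈ maximalGeodesicDomain cov x v :=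
    (continuous_const.mul continuous_id).continuousAt.preimage_mem_nhds (hmax.isOpen.mem_nhds hc)
  filter_upwards [hev] with r hr
  rw [add_zero, smul_smul, mul_comm r c]
  exact (expMap_smul_of_mem (cov := cov) x v hr).2

/-- The velocity at `r = 1` of `r ↦ exp_x(r (c v))` is `c γ_v'(c)` when `c ∈ dom γ_v`
(rescaling and the chain rule). [folklore] -/
theorem velocity_expMap_smul_smul_one (x : M) (v : TangentSpace I x) {c : ℝ}
    (hc : c ∈ maximalGeodesicDomain cov x v) :
    (velocity I (fun r : ℝ ↦ expMap cov x (r • (c • v))) 1 : E) =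
      c • velocity I (maximalGeodesic cov x v) c := by
  have heq := expMap_smul_smul_eventuallyEq (cov := cov) x v (r₀ := 1) (by rwa [mul_one])
  rw [velocity_congr_of_eventuallyEq heq, velocity_comp_affine (maximalGeodesic cov x v) c 0 1,
    mul_one, add_zero]

/-- `exp_x(r (c v)) = γ_v(c r)` at `r = 1`: `exp_x(c v) = γ_v(c)` (restated for radial curves).
[folklore] -/
theorem expMap_smul_smul_apply_one (x : M) (v : TangentSpace I x) {c : ℝ}
    (hc : c ∈ maximalGeodesicDomain cov x v) :
    expMap cov x ((1 : ℝ) • (c • v)) = maximalGeodesic cov x v c := by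
  rw [one_smul]
  exact (expMap_smul_of_mem (cov := cov) x v hc).2

end Flow

/-! ### First variation of the squared radial distance -/

namespace LorentzianMetric

variable {n : ℕ∞ω} {g : LorentzianMetric I n M} [g.HasLeviCivita]
  [CovariantDerivative.ContMDiffCovariantDerivative g.leviCivita 1]

/-- **First variation of the squared radial distance** (O'Neill 1983, Ch. 5, Lemma 5.33 with
Cor. 5.2): for `β` differentiable at `t` with `β t ∈ 𝓔_o`,
`d/ds g_o(β s, β s)|_t = 2 g(α'(t), P)`, `α = exp_o ∘ β`, `P` the velocity at `r = 1` of the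
radial geodesic `r ↦ exp_o(r β t)`. [cite: ONeillSemiRiemannian1983, Ch. 5, Lemma 5.33 (p. 147)] -/
theorem hasDerivAt_val_self_radial (hn : (∞ : ℕ∞ω) ≤ n) (o : M) {β : ℝ → E} {β' : E}
    {t : ℝ} (hβ : HasDerivAt β β' t)
    (hmem : (β t : TangentSpace I o) ∈ expDomain g.leviCivita o) :
    HasDerivAt (fun s ↦ g.val o (β s) (β s))
      (2 * g.val (expMap g.leviCivita o (β t))
        (velocity I (fun s ↦ expMap g.leviCivita o (β s)) t)
        (velocity I (fun r : ℝ ↦ expMap g.leviCivita o ((r • β t : E) : TangentSpace I o)) 1))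
      t := by
  let L : E →L[ℝ] E →L[ℝ] ℝ := g.val o
  have hL : HasDerivAt (fun s ↦ L (β s)) (L β') t := L.hasFDerivAt.comp_hasDerivAt t hβ
  have h : HasDerivAt (fun s ↦ L (β s) (β s)) (L β' (β t) + L (β t) β') t := hL.clm_apply hβ
  have hG := val_deriv_self_eq_val_velocity_radial (g := g) hn o hβ hmem
  refine h.congr_deriv ?_
  show g.val o β' (β t) + g.val o (β t) β' = _
  rw [g.symm o (β t) β', hG]
  ring

end LorentzianMetric

end Literature.Geometry.Lorentzian

end
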